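import Literature.NumberTheory.EllipticCurves.PadicWeierstrassZetaApproximants
import Literature.NumberTheory.EllipticCurves.PadicSigmaUniquenessProofs
import HarnessLib

/-!
# The Mazur–Tate constant, explicitly: `c·[x^{N-1}]f^m + [x^{N-2}]f^m ≡ 0 (mod N)`
# (Blakestad–Grant 2023, Prop. 3(c) + Lemma 4, with the explicit `z_N`; proofs only)

Trunk T-NT-EC (Literature/NumberTheory/EllipticCurves). Pure proof file combining
`PadicWeierstrassZetaApproximants.lean` (the explicit approximants `ζ_N`, `N = 2m+1`, of the
`p`-adic Weierstrass zeta function and the congruence `D ζ_N ≡ -x + J_N/H_N (mod N)`,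
`H_N = [x^{N-1}] f(x)^m`, `J_N = [x^{N-2}] f(x)^m`, `f = x³ + a₂x² + a₄x + a₆`) with
Blakestad–Grant's Lemma 4 ("`D f ≡ c (mod pⁿ)` for an integral Laurent series `f` forces
`c ≡ 0`", via the unit Hasse coefficient `w_{pⁿ-1}`), to the following CLOSED FORMULA for the
constant `β` of the `p`-adic Weierstrass zeta function (`D ζ = -x + β`, Blakestad–Grant Thm. 2;
tree: `PadicWeierstrassZetaProofs.lean`) and hence for the Mazur–Tate constant `c = -β` of a
Mazur–Tate sigma pair (`x + c = -D(Dσ/σ)`, Mazur–Stein–Tate 2006 Thm. 1.3, tree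
`IsMazurTateSigmaPair`):

  **`H_N · β ≡ J_N (mod N)`**, i.e. `β = lim_n [x^{pⁿ-2}] f^{(pⁿ-1)/2} / [x^{pⁿ-1}] f^{(pⁿ-1)/2}`,

whenever `w_{N-1}` is a unit (`ω = Σ wₙ zⁿ dz`; ordinary reduction). In Blakestad–Grant's
notation this is `β ≡ β_n = J_n/H_n (mod pⁿ)` (proof of Thm. 2) together with the explicit values
of `H_n`, `J_n` (their `z_n` is `-y·Q_N(x)`, `f^m = T_N + x^N Q_N`).

* `mem_of_coeff_clearedDeriv_one_sub_mem` — **Lemma 4, poles cleared**: if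
  `η(zF' - F) ≡ c z² (mod I)` coefficientwise for some `F ∈ R⟦z⟧` (i.e. `D(F/z) ≡ c`), `N ∈ I`
  and `w_{N-1} ∈ Rˣ`, then `c ∈ I`;
* `coeff_mul_sub_coeff_mem_of_clearedDeriv` — **`H_N β - J_N ∈ N·R`** for every `Λ ∈ R⟦z⟧` with
  `η(zΛ' - Λ) = -X + βz²` (`X = z²x`), e.g. Blakestad–Grant's zeta series of
  `PadicWeierstrassZetaProofs.lean` (`exists_padicWeierstrassZetaSeries`);
* over `ℚ_p`, for a `p`-integral model with `a₁ = a₃ = 0` and a Mazur–Tate sigma pair `(σ, c)`: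
  `clearedDeriv_one_sigmaG` (`g = zDσ/σ` solves `η(zg' - g) = -X - cz²`, the tree's sigma
  equation times `η = ω⁻¹`) and `IsMazurTateSigmaPair.norm_const_mul_add_le` —
  **`‖c·H_N + J_N‖ ≤ ‖N‖`** whenever `‖w_{N-1}‖ = 1`. With `N = pⁿ` (all `w_{pⁿ-1}` are units at
  an ordinary prime, `isUnit_coeff_formalInvDiff_prime_pow_sub_one` of
  `PadicWeierstrassZetaProofs.lean`) this says that the Mazur–Tate constant — and with it
  `E₂(E, ω) = a₁² + 4a₂ - 12c`, Mazur–Stein–Tate 2006 (1.7) — is the `p`-adic limit of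
  `-[x^{pⁿ-2}]f^{(pⁿ-1)/2}/[x^{pⁿ-1}]f^{(pⁿ-1)/2}`.

Numerical check (not part of the proofs): for `37a` (`y² + y = x³ - x`, short model
`y² = x³ - x + 1/4`) at `p = 5` the ratios give `β = 1 + 5 + 4·5² + ⋯`, Mazur–Stein–Tate's value
of `E₂(E,ω)/12` in §4.1 (2006).

## Sources

* C. Blakestad, D. Grant, *On the universal `p`-adic sigma and Weierstrass zeta functions*,
  J. Number Theory 249 (2023) (arXiv:1903.02480), §2.1: Prop. 3(c), Lemma 4 and its proof
  ("Since the coefficient of `t^{pⁿ-1}` in `df/dt` vanishes mod `pⁿ`, we have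
  `c_n w_{pⁿ-1} ≡ 0 mod pⁿ` … `w_{pⁿ-1} = H_n` is invertible"), proof of Thm. 2
  ("`β_{n+1} ≡ β_n mod pⁿ`, so we can set `β = lim β_n`"). [BlakestadGrant2023]
* B. Mazur, W. Stein, J. Tate, Doc. Math. Extra Vol. Coates (2006), Thm. 1.3, (1.7), §4.1.
  [MazurSteinTate2006]

Pure proof file: no definitions, no named facts.
-/

noncomputable section

open PowerSeries Literature.NumberTheory.EllipticCurves

namespace WeierstrassCurve

section Ring

variable {R : Type*} [CommRing R] (W : WeierstrassCurve R)

/-- **Blakestad–Grant's Lemma 4, poles cleared.** If `η·(zF' - F) ≡ c·z² (mod I)` coefficientwise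
(`𝒟₁(F) = z²·D(F/z)`, so this says `D(F/z) ≡ c`), with `N ∈ I` and `w_{N-1}` a unit
(`ω = Σ wₙzⁿdz = formalInvDiff`), then `c ∈ I`: the coefficient of `z^{N+1}` in `zF' - F` is
`N·F_{N+1} ∈ I`, while in `c z²·ω/dz` it is `c·w_{N-1}`. [Blakestad–Grant 2023, Lemma 4]
[cite: BlakestadGrant2023, Lemma 4] -/
theorem mem_of_coeff_clearedDeriv_one_sub_mem {I : Ideal R} {N : ℕ} (hN : (N : R) ∈ I)
    (hN1 : 1 ≤ N) (hw : IsUnit (coeff (N - 1) W.formalInvDiff)) {F : R⟦X⟧} {c : R}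
    (h : ∀ i, coeff i (W.clearedDeriv 1 F - C c * X ^ 2) ∈ I) : c ∈ I := by
  -- multiply by `ω/dz = η⁻¹`
  have hprod : W.formalInvDiff * (W.clearedDeriv 1 F - C c * X ^ 2) =
      (X * d⁄dX R F - F) - C c * (X ^ 2 * W.formalInvDiff) := by
    rw [clearedDeriv_def, Nat.cast_one, one_mul, mul_sub, ← mul_assoc, W.formalInvDiff_mul_formalEta,
      one_mul]
    ring
  have hmem := coeff_mul_mem_ideal_of_coeff_right_mem_ideal' (f := W.formalInvDiff) h (N + 1)
  rw [hprod, map_sub, map_sub, coeff_succ_X_mul, coeff_derivative, coeff_C_mul,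
    show N + 1 = (N - 1) + 2 by omega, coeff_X_pow_mul, show N - 1 + 2 = N + 1 by omega] at hmem
  have hNF : coeff (N + 1) F * ((N : R) + 1) - coeff (N + 1) F ∈ I := by
    have : coeff (N + 1) F * ((N : R) + 1) - coeff (N + 1) F = coeff (N + 1) F * N := by ring
    rw [this]
    exact I.mul_mem_left _ hN
  have hcw : c * coeff (N - 1) W.formalInvDiff ∈ I := by
    have := I.sub_mem hNF hmem
    rwa [sub_sub_cancel] at this
  obtain ⟨u, hu⟩ := hw.exists_right_inv
  have := I.mul_mem_right u hcw
  rwa [mul_assoc, hu, mul_one] at this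

variable [W.IsCharNeTwoNF]

/-- **`H_N·β ≡ J_N (mod N)` for the constant of ANY integral solution of `Dζ = -x + β`.** If
`Λ ∈ R⟦z⟧` satisfies `η(zΛ' - Λ) = -X + βz²` (i.e. `ζ = Λ/z` has `Dζ = -x + β`), `N = 2m + 1 ≥ 3`
and `w_{N-1}` is a unit, then `[x^{N-1}]f^m · β - [x^{N-2}]f^m ∈ N·R`. (Apply Lemma 4 to
`H_N Λ - H_N tζ_N`, whose `𝒟₁` is `≡ (H_Nβ - J_N)z²` by `coeff_clearedDeriv_zetaApproxNum_sub_mem`.)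
In particular for Blakestad–Grant's zeta series (`exists_padicWeierstrassZetaSeries`,
`PadicWeierstrassZetaProofs.lean`): their `β = lim β_n` is
`lim [x^{pⁿ-2}]f^{(pⁿ-1)/2} / [x^{pⁿ-1}]f^{(pⁿ-1)/2}`. [Blakestad–Grant 2023, proof of Thm. 2
("`β_{n+1} ≡ β_n mod pⁿ`") with Prop. 3(c)] [cite: BlakestadGrant2023, Thm. 2] -/
theorem coeff_mul_sub_coeff_mem_of_clearedDeriv {m : ℕ} (hm : 1 ≤ m)
    (hw : IsUnit (coeff (2 * m) W.formalInvDiff)) {Λ : R⟦X⟧} {β : R}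
    (hΛ : W.clearedDeriv 1 Λ = -W.formalXMulSq + C β * X ^ 2) :
    (W.rhsCubic ^ m).coeff (2 * m) * β - (W.rhsCubic ^ m).coeff (2 * m - 1) ∈
      Ideal.span {(2 * (m : R) + 1)} := by
  set H := (W.rhsCubic ^ m).coeff (2 * m)
  set J := (W.rhsCubic ^ m).coeff (2 * m - 1)
  refine W.mem_of_coeff_clearedDeriv_one_sub_mem (N := 2 * m + 1) (by push_cast; exact Ideal.subset_span rfl)
    (by omega) (by rwa [Nat.add_sub_cancel]) (F := C H * Λ - W.zetaApproxNum m) fun i => ?_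
  have key := W.coeff_clearedDeriv_zetaApproxNum_sub_mem hm i
  have e : W.clearedDeriv 1 (C H * Λ - W.zetaApproxNum m) - C (H * β - J) * X ^ 2 =
      -(W.clearedDeriv 1 (W.zetaApproxNum m) - (C J * X ^ 2 - C H * W.formalXMulSq)) := by
    rw [clearedDeriv_sub, clearedDeriv_C_mul, hΛ, map_sub, map_mul]
    ring
  rw [e, map_neg]
  exact Submodule.neg_mem (Ideal.span {(2 * (m : R) + 1)}) key

end Ring

/-! ### Over `ℚ_p`: the Mazur–Tate constant -/

section Padic

/-- `rhsCubic` commutes with base change. [folklore] -/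
theorem map_rhsCubic {A B : Type*} [CommRing A] [CommRing B] (V : WeierstrassCurve A) (φ : A →+* B) :
    (V.map φ).rhsCubic = V.rhsCubic.map φ := by
  simp only [rhsCubic_def, map_a₂, map_a₄, map_a₆, Polynomial.map_add, Polynomial.map_mul,
    Polynomial.map_pow, Polynomial.map_X, Polynomial.map_C]

/-- `d/dz` commutes with base change. [folklore] -/
theorem _root_.Literature.NumberTheory.EllipticCurves.powerSeries_map_derivative {A B : Type*}
    [CommRing A] [CommRing B] (φ : A →+* B) (F : A⟦X⟧) :
    PowerSeries.map φ (d⁄dX A F) = d⁄dX B (PowerSeries.map φ F) := by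
  ext n
  simp only [coeff_map, coeff_derivative, map_mul, map_add, map_natCast, map_one]

/-- `clearedDeriv` commutes with base change. [folklore] -/
theorem map_clearedDeriv {A B : Type*} [CommRing A] [CommRing B] (V : WeierstrassCurve A) (φ : A →+* B)
    (M : ℕ) (F : A⟦X⟧) :
    PowerSeries.map φ (V.clearedDeriv M F) = (V.map φ).clearedDeriv M (PowerSeries.map φ F) := by
  rw [clearedDeriv_def, clearedDeriv_def, map_mul, V.map_formalEta φ, map_sub, map_mul, map_mul, map_X,
    powerSeries_map_derivative, map_natCast]

variable {p : ℕ} [Fact p.Prime] (W : WeierstrassCurve ℚ_[p])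

/-- **For a Mazur–Tate sigma pair the series `g = tDσ/σ` solves `𝒟₁(g) = -X - c z²`**: the
tree's pole-cleared sigma equation `ω(X + cz²) = g - zg'` (`SatisfiesSigmaODE`, `g = sigmaG`)
multiplied by `η = ω⁻¹`. So `ζ = Dσ/σ = g/z` is an integral solution of `Dζ = -x + β` with
`β = -c`. [Mazur–Stein–Tate 2006, Thm. 1.3; Blakestad–Grant 2023, §2.2 (`ζ = D(log σ)`)]
[cite: MazurSteinTate2006, Thm. 1.3] -/
theorem clearedDeriv_one_sigmaG {σ : ℚ_[p]⟦X⟧} {c : ℚ_[p]} (h : W.SatisfiesSigmaODE σ c) :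
    W.clearedDeriv 1 (W.sigmaG σ) = -W.formalXMulSq + C (-c) * X ^ 2 := by
  rw [satisfiesSigmaODE_iff] at h
  have hηω := W.formalEta_mul_formalOmega
  rw [clearedDeriv_def, Nat.cast_one, one_mul, map_neg]
  linear_combination W.formalEta * h - (W.formalXMulSq + C c * X ^ 2) * hηω

/-- The inclusion `ℤ_p → ℚ_p` is injective. [folklore] -/
theorem _root_.Literature.NumberTheory.EllipticCurves.padicInt_coe_ringHom_injective :
    Function.Injective (PadicInt.Coe.ringHom (p := p)) :=
  fun _ _ hab => Subtype.ext hab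

variable [W.IsIntegral ℤ_[p]]

/-- The integral model of a `p`-integral `W` with `a₁ = a₃ = 0` has `a₁ = a₃ = 0`. [folklore] -/
theorem isCharNeTwoNF_integralModel [W.IsCharNeTwoNF] : (W.integralModel ℤ_[p]).IsCharNeTwoNF := by
  have h := W.eq_map_integralModel
  have hinj := padicInt_coe_ringHom_injective (p := p)
  constructor
  · have h1 : PadicInt.Coe.ringHom (W.integralModel ℤ_[p]).a₁ = W.a₁ := by
      conv_rhs => rw [← h]
      rfl
    rw [W.a₁_of_isCharNeTwoNF, ← map_zero (PadicInt.Coe.ringHom (p := p))] at h1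
    exact hinj h1
  · have h3 : PadicInt.Coe.ringHom (W.integralModel ℤ_[p]).a₃ = W.a₃ := by
      conv_rhs => rw [← h]
      rfl
    rw [W.a₃_of_isCharNeTwoNF, ← map_zero (PadicInt.Coe.ringHom (p := p))] at h3
    exact hinj h3

variable [W.IsCharNeTwoNF]

/-- **The Mazur–Tate constant, explicitly.** For a `p`-integral model `y² = x³ + a₂x² + a₄x + a₆`
over `ℚ_p`, a Mazur–Tate sigma pair `(σ, c)` (`x + c = -D(Dσ/σ)`, `σ ∈ t + t²ℤ_p⟦t⟧`, `c ∈ ℤ_p`)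
and `N = 2m + 1 ≥ 3` with `‖w_{N-1}‖ = 1` (`ω = Σ wₙzⁿdz`; at an ordinary prime every `w_{pⁿ-1}`
qualifies): **`‖c·[x^{N-1}]f^m + [x^{N-2}]f^m‖ ≤ ‖N‖`** (`f = x³ + a₂x² + a₄x + a₆`). With
`N = pⁿ` this says `c ≡ -J_n/H_n (mod pⁿ)`: the Mazur–Tate constant is the `p`-adic limit of
`-[x^{pⁿ-2}]f^{(pⁿ-1)/2}/[x^{pⁿ-1}]f^{(pⁿ-1)/2}`. [Blakestad–Grant 2023, Prop. 3(c), Lemma 4,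
Thm. 2 (proof); Mazur–Stein–Tate 2006, Thm. 1.3, (1.7)] [cite: BlakestadGrant2023, Thm. 2] -/
theorem IsMazurTateSigmaPair.norm_const_mul_add_le {σ : ℚ_[p]⟦X⟧} {c : ℚ_[p]}
    (h : W.IsMazurTateSigmaPair σ c) {m : ℕ} (hm : 1 ≤ m) (hw : ‖coeff (2 * m) W.formalOmega‖ = 1) :
    ‖c * (W.rhsCubic ^ m).coeff (2 * m) + (W.rhsCubic ^ m).coeff (2 * m - 1)‖ ≤
      ‖(2 * (m : ℚ_[p]) + 1)‖ := by
  -- descend everything to `ℤ_p`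
  set V := W.integralModel ℤ_[p] with hV
  set φ : ℤ_[p] →+* ℚ_[p] := PadicInt.Coe.ringHom with hφ
  have hφi : Function.Injective φ := padicInt_coe_ringHom_injective
  have hVW : V.map φ = W := W.eq_map_integralModel
  haveI : V.IsCharNeTwoNF := W.isCharNeTwoNF_integralModel
  -- the integral lift of `g = tDσ/σ` and of `c`
  have hg : IsPadicInt (W.sigmaG σ) := W.isPadicInt_sigmaG (isPadicInt_sigma h) h.coeff_one_eq
  obtain ⟨G, hG⟩ := isPadicInt_iff_exists_powerSeries_map.mp hg
  obtain ⟨c', hc'⟩ : ∃ c' : ℤ_[p], (c' : ℚ_[p]) = c := ⟨⟨c, h.norm_const_le⟩, rfl⟩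
  -- the equation `𝒟₁ G = -X - c' z²` over `ℤ_p`
  have hmapRHS : PowerSeries.map φ (-V.formalXMulSq + C (-c') * X ^ 2) =
      -W.formalXMulSq + C (-c) * X ^ 2 := by
    rw [map_add, map_neg, V.map_formalXMulSq φ, hVW, map_mul, map_pow, map_X, map_C, map_neg]
    congr 3
    exact congrArg Neg.neg hc'
  have hGeq : V.clearedDeriv 1 G = -V.formalXMulSq + C (-c') * X ^ 2 := by
    apply PowerSeries.map_injective φ hφi
    rw [V.map_clearedDeriv φ 1 G, hVW, hmapRHS, ← W.clearedDeriv_one_sigmaG h.ode, ← hG]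
  -- the Hasse coefficient is a unit of `ℤ_p`
  have h1 : W.formalOmega = PowerSeries.map φ V.formalInvDiff := by
    rw [V.map_formalInvDiff φ, hVW, W.formalInvDiff_eq_formalOmega]
  have hwV : IsUnit (coeff (2 * m) V.formalInvDiff) := by
    rw [PadicInt.isUnit_iff]
    rw [h1, coeff_map] at hw
    exact_mod_cast hw
  have hmem := V.coeff_mul_sub_coeff_mem_of_clearedDeriv hm hwV hGeq
  -- compare coefficients of `f^m` over `ℤ_p` and `ℚ_p`
  have hcoeff : ∀ k, ((V.rhsCubic ^ m).coeff k : ℚ_[p]) = (W.rhsCubic ^ m).coeff k := fun k => by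
    rw [← hVW, map_rhsCubic, ← Polynomial.map_pow, Polynomial.coeff_map]; rfl
  obtain ⟨q, hq⟩ := Ideal.mem_span_singleton'.mp hmem
  have hnorm : ‖((V.rhsCubic ^ m).coeff (2 * m) * -c' - (V.rhsCubic ^ m).coeff (2 * m - 1) : ℤ_[p])‖ ≤
      ‖(2 * (m : ℤ_[p]) + 1)‖ := by
    rw [← hq]
    exact (norm_mul_le _ _).trans (mul_le_of_le_one_left (norm_nonneg _) (PadicInt.norm_le_one _))
  have e : c * (W.rhsCubic ^ m).coeff (2 * m) + (W.rhsCubic ^ m).coeff (2 * m - 1) =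
      -(((V.rhsCubic ^ m).coeff (2 * m) * -c' - (V.rhsCubic ^ m).coeff (2 * m - 1) : ℤ_[p]) : ℚ_[p]) := by
    push_cast
    rw [hcoeff, hcoeff, hc']
    ring
  rw [e, norm_neg, PadicInt.padic_norm_e_of_padicInt]
  refine hnorm.trans_eq ?_
  rw [← PadicInt.padic_norm_e_of_padicInt]
  push_cast
  rfl

end Padic

end WeierstrassCurve
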